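import Summits.QuantumFields.BalabanUV.Beta.FP.SliceProjectorSymbol
import Summits.QuantumFields.BalabanUV.Beta.FP.SliceProjectorAliasIndex

/-!
# `BalabanUV.Beta.FP.SliceProjectorAliasSum` — road «FP» (binder row D1), organisation γ, row GAMMA-3 (c, estimate II + END): **THE n-UNIFORM
# ALIAS-SUM ESTIMATE `Σ_l ‖qa_l‖·‖e_l‖ ≤ C_qe(D)` ON THE FAT STRIP, HENCE `‖S_{ab}‖ ≤ M_S` ON `Strip D κ_Y`, `StripRegular S_{ab} κ_Y M_S`, AND
# THE EXPONENTIAL DECAY OF THE FINE KERNEL OF `1 − Π`: `‖latticeKernel S_{ab} X‖ ≤ M_S·e^{−κ_Y‖X‖∞}`, `M_S ≤ C_S(D)` FOR INTRA-BLOCK OFFSETS**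

HONEST FRAMING (cell contract, verbatim): «discharging `BetaPertH` makes Bałaban's UV stability UNCONDITIONAL — a real constructive-QFT
result; it is NOT the continuum limit and NOT the Clay problem.»  HONEST DEPENDENCY (verbatim): «continuum YM on T⁴ ⇐ BetaPertH ∧ nine
spine estimates (0/9 proved); BetaPertH ⇐ (D1) ∧ (D4) ∧ CAP+tail; G-an2-4 gates asym, D1 and NE2/3/4.»  THIS MODULE DISCHARGES NOTHING of
D1 ∕ BetaPertH: [folklore] one elementary estimate — the term `l ↦ ‖qa_l‖·‖e_l‖` is dominated by the PRODUCT weight `(1024/7)D·Π_i wt(l_i)`,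
`wt(j) = c₁·(j̃·j̃^{1/D})⁻¹`: the residue-index decay `‖qa_l‖ ≤ Π c₁/j̃` (`SliceProjectorAliasIndex`) times `‖e_l‖ ≤ 16D/‖Δ^ξ(k+2πl)‖`
with `j̃(l_i)² ≤ (64/7)‖Δ^ξ(k+2πl)‖` for EVERY `i` (`B4StripCauchy.re_Sxi_ge` BY NAME) distributed geometrically as `Π_i j̃_i^{1/D} ≤ (64/7)‖Δ^ξ_l‖`;
then `Σ_l Π_i wt(l_i) = (Σ_j wt j)^D` (`Finset.prod_univ_sum`) and the p-series; assembly over `SliceProjectorSymbol.stripRegular_S_of_bound`.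
[our object] data defs `eD`, `wt`, `Cqe`, `l1`, `cN`, `MS`, `CS`; no `def … : Prop`; nothing is cited; 0 sorry.  NOT summit progress; NOT hbook,
NOT D1, NOT BetaPertH, NOT continuum, NOT Clay.

ABSOLUTE RULE (cell, verbatim): «No internally-minted statement may enter as a cited fact. Every hypothesis is either kernel-proved in this
package or a verbatim quotation of a PUBLISHED theorem with page reference. The manuscript(s) under audit are NOT citable for their own
disputed steps — they are the thing under adjudication; programme-internal (2001/route/tribunal) claims are never citable.»

CONTENT (`D = d+1`, fat strip `Fat D (rOf D)` ⊇ `Strip D κ_Y`):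
* §1 **`jt_sq_le_norm_DeltaXi_shift`** (`l ≠ 0`, every `i`), `eD`, **`prod_jt_rpow_le`**, **`norm_ew_mul_prod_le`** (`‖e_l‖·Π_i j̃_i^{1/D} ≤ (1024/7)D`),
  `wt`, `prod_wt_eq`, **`norm_qa_mul_ew_le`∕`norm_qb_mul_ew_le`**.
* §2 `Cqe`, `sum_wt_le`, `sum_prod_wt_eq`, **`sum_norm_qa_mul_ew_le`∕`sum_norm_qb_mul_ew_le`** (`≤ Cqe D`, every `n ≥ 1`).
* §3 END: `norm_cphase_le`, `norm_Aent_eq`, **`norm_S_le`** (`‖S n a b k‖ ≤ MS d n a b` on the strip), **`stripRegular_S`**,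
  **`norm_latticeKernel_S_le`**, `MS_le_CS`, **`norm_latticeKernel_S_le_uniform`** (`|a_μ|, |b_μ| ≤ n ⟹ ‖latticeKernel (S n a b) X‖ ≤ CS(D)·e^{−κ_Y‖X‖∞}`,
  n-UNIFORM — in the reading of `SliceProjectorSymbol`: `|(1−Π)(nX+a, nY+b)| ≤ CS(D)·n^{−D}·e^{−κ_Y|X−Y|∞}`, GAMMA-DESIGN §3 at the zeroth B-jet).
Unit `b2b-balaban-beta-d1-formalise-leaf-06` (gen 8), organisation γ (R-FP-25), row GAMMA-3 (c); parts (a) p244337 ✓, (b) p244695.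
-/

noncomputable section

namespace Summit.QuantumFields.BalabanUV.Beta.FP.SliceProjectorAliasSum

open Complex Set Finset
open scoped BigOperators Real
open Literature.MathematicalPhysics.QuantumFieldTheory.Balaban1983to89
open B4Strip (Strip DeltaXi Sxi shift)
open B4StripCauchy (Fat strip_subset_fat rOf rOf_pos rOf_le d_mul_rOf_sq_le norm_DeltaXi_le norm_DeltaXi_shift_ge re_Sxi_ge
  shiftc_re shiftc_im)
open B5Strip145 (Ncal)
open B4ContourShift (StripRegular latticeKernel supNorm)
open Beta.FibreInverseDecay (cphase)
open Summit.QuantumFields.BalabanUV.Beta.GAN24.AliasDecimate (aliasPt)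
open Summit.QuantumFields.BalabanUV.Beta.FP.CoarseCovarianceStripAliasWeights (aliasPt_im)
open Summit.QuantumFields.BalabanUV.Beta.FP.SliceProjectorMidInv
open Summit.QuantumFields.BalabanUV.Beta.FP.SliceProjectorEntries
open Summit.QuantumFields.BalabanUV.Beta.FP.SliceProjectorSymbol
open Summit.QuantumFields.BalabanUV.Beta.FP.SliceProjectorAliasIndex

variable {d : ℕ}

/-! ## §1 The shifted symbol dominates the residue-index weights; the product majorant -/

/-- [folklore] **THE SHIFTED SYMBOL DOMINATES EVERY RESIDUE-INDEX WEIGHT**: for `l ≠ 0` and every coordinate `i`,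
`j̃(l_i)² ≤ (64/7)·‖Δ^ξ(p + 2πl)‖` on the fat strip (`Re Δ^ξ(p+2πl) ≥ Σ_ν [4n² sin² − (25/16)(Im p_ν)²] ≥ j̃(l_i)²/2 − 25/64`). -/
theorem jt_sq_le_norm_DeltaXi_shift (n : ℕ) [NeZero n] {p : Fin (d + 1) → ℂ} (hp : p ∈ Fat (d + 1) (rOf (d + 1)))
    (l : Fin (d + 1) → Fin n) (hl : l ≠ fun _ => 0) (i : Fin (d + 1)) :
    jt n (l i) ^ 2 ≤ 64 / 7 * ‖DeltaXi n 0 (shift n l p)‖ := by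
  have hn1 : 1 ≤ n := Nat.one_le_iff_ne_zero.mpr (NeZero.ne n)
  have h2 : 2 ≤ ‖DeltaXi n 0 (shift n l p)‖ :=
    norm_DeltaXi_shift_ge n 0 le_rfl (rOf_le (d + 1)) (by exact_mod_cast d_mul_rOf_sq_le (d + 1)) hp l hl
  by_cases h0 : ((l i : ℕ)) = 0
  · rw [jt_of_val_zero h0]; linarith
  · have hre : (DeltaXi n 0 (shift n l p)).re = ∑ ν, (Sxi n (p ν + 2 * Real.pi * ((l ν : ℕ) : ℂ))).re := by
      simp [DeltaXi, shift, Complex.re_sum]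
    have hterm : ∀ ν, 4 * (n : ℝ) ^ 2 * Real.sin (((p ν).re + 2 * Real.pi * ((l ν : ℕ) : ℝ)) / (2 * n)) ^ 2 - 25 / 16 * ((p ν).im) ^ 2
        ≤ (Sxi n (p ν + 2 * Real.pi * ((l ν : ℕ) : ℂ))).re := by
      intro ν
      have h := re_Sxi_ge n hn1 (p ν + 2 * Real.pi * ((l ν : ℕ) : ℂ)) (by rw [shiftc_im]; exact (fat_facts hp ν).2)
      rwa [shiftc_re, shiftc_im] at h
    have hsum_im : ∑ ν : Fin (d + 1), ((p ν).im) ^ 2 ≤ 1 / 4 := by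
      have hr := d_mul_rOf_sq_le (d + 1)
      push_cast at hr
      have h1 : ∀ ν, ((p ν).im) ^ 2 ≤ (2 * rOf (d + 1)) ^ 2 := fun ν => by
        have h := abs_le.1 (hp ν).2
        exact sq_le_sq' (by linarith) h.2
      calc ∑ ν, ((p ν).im) ^ 2 ≤ ∑ _ν : Fin (d + 1), (2 * rOf (d + 1)) ^ 2 := Finset.sum_le_sum fun ν _ => h1 ν
        _ = ((d : ℝ) + 1) * rOf (d + 1) ^ 2 * 4 := by
            rw [Finset.sum_const, Finset.card_univ, Fintype.card_fin]; ring
        _ ≤ 1 / 4 := by linarith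
    have hsin := jt_sq_le_sin n (fat_facts hp i).1 (l i) h0
    have hS : 4 * (n : ℝ) ^ 2 * Real.sin (((p i).re + 2 * Real.pi * ((l i : ℕ) : ℝ)) / (2 * n)) ^ 2
        ≤ ∑ ν, 4 * (n : ℝ) ^ 2 * Real.sin (((p ν).re + 2 * Real.pi * ((l ν : ℕ) : ℝ)) / (2 * n)) ^ 2 :=
      Finset.single_le_sum (f := fun ν => 4 * (n : ℝ) ^ 2 * Real.sin (((p ν).re + 2 * Real.pi * ((l ν : ℕ) : ℝ)) / (2 * n)) ^ 2)
        (fun ν _ => by positivity) (Finset.mem_univ i)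
    have hge : jt n (l i) ^ 2 / 2 - 25 / 64 ≤ (DeltaXi n 0 (shift n l p)).re := by
      rw [hre]
      calc jt n (l i) ^ 2 / 2 - 25 / 64
          ≤ ∑ ν, (4 * (n : ℝ) ^ 2 * Real.sin (((p ν).re + 2 * Real.pi * ((l ν : ℕ) : ℝ)) / (2 * n)) ^ 2 - 25 / 16 * ((p ν).im) ^ 2) := by
            have e1 : ∑ ν : Fin (d + 1), 25 / 16 * ((p ν).im) ^ 2 = 25 / 16 * ∑ ν : Fin (d + 1), ((p ν).im) ^ 2 := by
              rw [Finset.mul_sum]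
            rw [Finset.sum_sub_distrib, e1]; linarith
        _ ≤ _ := Finset.sum_le_sum fun ν _ => hterm ν
    have hj2 : 1 ≤ jt n (l i) ^ 2 := one_le_pow₀ (one_le_jt (l i))
    have hrn : (DeltaXi n 0 (shift n l p)).re ≤ ‖DeltaXi n 0 (shift n l p)‖ := Complex.re_le_norm _
    linarith

/-- [our object] the distribution exponent `eD := 1/D`. -/
def eD (d : ℕ) : ℝ := 1 / ((d : ℝ) + 1)

/-- [folklore] `0 < eD`. -/
theorem eD_pos (d : ℕ) : 0 < eD d := by unfold eD; positivity

/-- [folklore] `eD ≤ 1`. -/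
theorem eD_le_one (d : ℕ) : eD d ≤ 1 := by
  unfold eD
  have : (0 : ℝ) ≤ d := Nat.cast_nonneg d
  rw [div_le_one (by positivity)]; linarith

/-- [folklore] `eD·D = 1`. -/
theorem eD_mul (d : ℕ) : eD d * ((d : ℝ) + 1) = 1 := by
  unfold eD
  have : (0 : ℝ) < (d : ℝ) + 1 := by positivity
  field_simp

/-- [folklore] `eD⁻¹ = D`. -/
theorem eD_inv (d : ℕ) : (eD d)⁻¹ = (d : ℝ) + 1 := by unfold eD; rw [one_div, inv_inv]

/-- [folklore] **GEOMETRIC DISTRIBUTION**: `Π_i j̃(l_i)^{1/D} ≤ (64/7)·‖Δ^ξ(p+2πl)‖` for `l ≠ 0` (each `j̃ ≤ j̃² ≤` the bound, which is `≥ 1`). -/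
theorem prod_jt_rpow_le (n : ℕ) [NeZero n] {p : Fin (d + 1) → ℂ} (hp : p ∈ Fat (d + 1) (rOf (d + 1)))
    (l : Fin (d + 1) → Fin n) (hl : l ≠ fun _ => 0) :
    ∏ i, jt n (l i) ^ eD d ≤ 64 / 7 * ‖DeltaXi n 0 (shift n l p)‖ := by
  set B := 64 / 7 * ‖DeltaXi n 0 (shift n l p)‖ with hB
  have hB0 : 0 ≤ B := by positivity
  have hle : ∀ i, jt n (l i) ≤ B := fun i => by
    have h := jt_sq_le_norm_DeltaXi_shift n hp l hl i
    have h1 := one_le_jt (l i)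
    nlinarith
  calc ∏ i, jt n (l i) ^ eD d ≤ ∏ _i : Fin (d + 1), B ^ eD d :=
        Finset.prod_le_prod (fun i _ => Real.rpow_nonneg (jt_pos _).le _)
          fun i _ => Real.rpow_le_rpow (jt_pos _).le (hle i) (eD_pos d).le
    _ = B := by
        rw [Finset.prod_const, Finset.card_univ, Fintype.card_fin, ← Real.rpow_natCast, ← Real.rpow_mul hB0]
        push_cast
        rw [eD_mul, Real.rpow_one]

/-- [folklore] **`‖e_l‖·Π_i j̃(l_i)^{1/D} ≤ (1024/7)·D`** on the fat strip, every `l` (`‖Δ^ξ(p)‖ ≤ 16D`; `l = 0`: both factors `1`). -/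
theorem norm_ew_mul_prod_le (n : ℕ) [NeZero n] {p : Fin (d + 1) → ℂ} (hp : p ∈ Fat (d + 1) (rOf (d + 1)))
    (l : Fin (d + 1) → Fin n) : ‖ew n l p‖ * ∏ i, jt n (l i) ^ eD d ≤ 1024 / 7 * ((d : ℝ) + 1) := by
  have hn1 : 1 ≤ n := Nat.one_le_iff_ne_zero.mpr (NeZero.ne n)
  have hd : (0 : ℝ) ≤ d := Nat.cast_nonneg d
  by_cases hl : l = fun _ => 0
  · subst hl
    rw [ew_zero, norm_one, one_mul]
    have h1 : ∀ i : Fin (d + 1), jt n ((fun _ : Fin (d + 1) => (0 : Fin n)) i) ^ eD d = 1 := fun i => by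
      rw [jt_of_val_zero (Fin.val_zero n), Real.one_rpow]
    rw [Finset.prod_congr rfl fun i _ => h1 i, Finset.prod_const_one]
    linarith
  · have h16 : ‖DeltaXi n 0 p‖ ≤ 16 * ((d : ℝ) + 1) := by
      have h := norm_DeltaXi_le n hn1 0 le_rfl (rOf_le (d + 1)) hp
      push_cast at h; linarith
    have h2 : 2 ≤ ‖DeltaXi n 0 (shift n l p)‖ :=
      norm_DeltaXi_shift_ge n 0 le_rfl (rOf_le (d + 1)) (by exact_mod_cast d_mul_rOf_sq_le (d + 1)) hp l hl
    have hne : ‖DeltaXi n 0 (shift n l p)‖ ≠ 0 := by linarith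
    have hprod := prod_jt_rpow_le n hp l hl
    rw [ew_ne n hl, norm_div]
    calc ‖DeltaXi n 0 p‖ / ‖DeltaXi n 0 (shift n l p)‖ * ∏ i, jt n (l i) ^ eD d
        ≤ ‖DeltaXi n 0 p‖ / ‖DeltaXi n 0 (shift n l p)‖ * (64 / 7 * ‖DeltaXi n 0 (shift n l p)‖) :=
          mul_le_mul_of_nonneg_left hprod (by positivity)
      _ = 64 / 7 * ‖DeltaXi n 0 p‖ := by field_simp
      _ ≤ 1024 / 7 * ((d : ℝ) + 1) := by linarith

/-- [our object] the one-coordinate product weight `wt d n j := c₁·(j̃·j̃^{1/D})⁻¹`. -/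
def wt (d n : ℕ) (j : Fin n) : ℝ := c1 * (jt n j * jt n j ^ eD d)⁻¹

/-- [folklore] `0 ≤ wt`. -/
theorem wt_nonneg (d n : ℕ) (j : Fin n) : 0 ≤ wt d n j := by
  unfold wt
  exact mul_nonneg c1_pos.le (inv_nonneg.2 (mul_nonneg (jt_pos _).le (Real.rpow_nonneg (jt_pos _).le _)))

/-- [folklore] the product form of the weight: `Π_i wt (l_i) = (Π_i c₁/j̃_i)·(Π_i j̃_i^{1/D})⁻¹`. -/
theorem prod_wt_eq (d n : ℕ) (l : Fin (d + 1) → Fin n) :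
    ∏ i, wt d n (l i) = (∏ i, c1 / jt n (l i)) * (∏ i, jt n (l i) ^ eD d)⁻¹ := by
  rw [← Finset.prod_inv_distrib, ← Finset.prod_mul_distrib]
  refine Finset.prod_congr rfl fun i _ => ?_
  rw [wt, mul_inv, div_eq_mul_inv, mul_assoc]

/-- [folklore] **THE PRODUCT MAJORANT**: `‖qa_l‖·‖e_l‖ ≤ (1024/7)·D·Π_i wt(l_i)` on the fat strip, every `l`. -/
theorem norm_qa_mul_ew_le (n : ℕ) [NeZero n] {p : Fin (d + 1) → ℂ} (hp : p ∈ Fat (d + 1) (rOf (d + 1)))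
    (l : Fin (d + 1) → Fin n) : ‖qa n l p‖ * ‖ew n l p‖ ≤ 1024 / 7 * ((d : ℝ) + 1) * ∏ i, wt d n (l i) := by
  have hP0 : 0 < ∏ i, jt n (l i) ^ eD d := Finset.prod_pos fun i _ => Real.rpow_pos_of_pos (jt_pos _) _
  have hK : ‖ew n l p‖ ≤ 1024 / 7 * ((d : ℝ) + 1) * (∏ i, jt n (l i) ^ eD d)⁻¹ := by
    rw [← div_eq_mul_inv, le_div_iff₀ hP0]; exact norm_ew_mul_prod_le n hp l
  rw [prod_wt_eq]
  calc ‖qa n l p‖ * ‖ew n l p‖ ≤ (∏ i, c1 / jt n (l i)) * (1024 / 7 * ((d : ℝ) + 1) * (∏ i, jt n (l i) ^ eD d)⁻¹) :=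
        mul_le_mul (norm_qa_le_prod n hp l) hK (norm_nonneg _) (Finset.prod_nonneg fun i _ => div_nonneg c1_pos.le (jt_pos _).le)
    _ = _ := by ring

/-- [folklore] the same for the column weights: `‖qb_l‖·‖e_l‖ ≤ (1024/7)·D·Π_i wt(l_i)`. -/
theorem norm_qb_mul_ew_le (n : ℕ) [NeZero n] {p : Fin (d + 1) → ℂ} (hp : p ∈ Fat (d + 1) (rOf (d + 1)))
    (l : Fin (d + 1) → Fin n) : ‖qb n l p‖ * ‖ew n l p‖ ≤ 1024 / 7 * ((d : ℝ) + 1) * ∏ i, wt d n (l i) := by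
  have hP0 : 0 < ∏ i, jt n (l i) ^ eD d := Finset.prod_pos fun i _ => Real.rpow_pos_of_pos (jt_pos _) _
  have hK : ‖ew n l p‖ ≤ 1024 / 7 * ((d : ℝ) + 1) * (∏ i, jt n (l i) ^ eD d)⁻¹ := by
    rw [← div_eq_mul_inv, le_div_iff₀ hP0]; exact norm_ew_mul_prod_le n hp l
  rw [prod_wt_eq]
  calc ‖qb n l p‖ * ‖ew n l p‖ ≤ (∏ i, c1 / jt n (l i)) * (1024 / 7 * ((d : ℝ) + 1) * (∏ i, jt n (l i) ^ eD d)⁻¹) :=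
        mul_le_mul (norm_qb_le_prod n hp l) hK (norm_nonneg _) (Finset.prod_nonneg fun i _ => div_nonneg c1_pos.le (jt_pos _).le)
    _ = _ := by ring

/-! ## §2 The n-uniform alias sums -/

/-- [our object] **THE ALIAS-SUM CONSTANT** `Cqe D := (1024/7)·D·(c₁·2(1 + D))^{D}` (dimension only). -/
def Cqe (d : ℕ) : ℝ := 1024 / 7 * ((d : ℝ) + 1) * (c1 * (2 * (1 + ((d : ℝ) + 1)))) ^ (d + 1)

/-- [folklore] `0 ≤ Cqe`. -/
theorem Cqe_nonneg (d : ℕ) : 0 ≤ Cqe d := by have := c1_pos; unfold Cqe; positivity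

/-- [folklore] the one-coordinate weight sum: `Σ_j wt j ≤ c₁·2(1 + D)`, every `n`. -/
theorem sum_wt_le (d n : ℕ) : ∑ j : Fin n, wt d n j ≤ c1 * (2 * (1 + ((d : ℝ) + 1))) := by
  rw [show ∑ j : Fin n, wt d n j = c1 * ∑ j : Fin n, (jt n j * jt n j ^ eD d)⁻¹ by rw [Finset.mul_sum]; rfl]
  refine mul_le_mul_of_nonneg_left ?_ c1_pos.le
  have h := sum_inv_jt_rpow_le n (eD_pos d) (eD_le_one d)
  rwa [eD_inv] at h

/-- [folklore] the product structure: `Σ_l Π_i wt(l_i) = (Σ_j wt j)^{D}` (`Finset.prod_univ_sum`). -/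
theorem sum_prod_wt_eq (d n : ℕ) : ∑ l : Fin (d + 1) → Fin n, ∏ i, wt d n (l i) = (∑ j : Fin n, wt d n j) ^ (d + 1) := by
  have h := Finset.prod_univ_sum (fun _ : Fin (d + 1) => (Finset.univ : Finset (Fin n))) (fun _ j => wt d n j)
  rw [Fintype.piFinset_univ] at h
  rw [← h, Finset.prod_const, Finset.card_univ, Fintype.card_fin]

/-- [our object] **THE n-UNIFORM ROW ALIAS SUM**: `Σ_l ‖qa_l‖·‖e_l‖ ≤ Cqe D` on the fat strip `Fat D (rOf D)`, every `n ≥ 1`. -/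
theorem sum_norm_qa_mul_ew_le (n : ℕ) [NeZero n] {p : Fin (d + 1) → ℂ} (hp : p ∈ Fat (d + 1) (rOf (d + 1))) :
    ∑ l : Fin (d + 1) → Fin n, ‖qa n l p‖ * ‖ew n l p‖ ≤ Cqe d := by
  have hw0 : 0 ≤ ∑ j : Fin n, wt d n j := Finset.sum_nonneg fun j _ => wt_nonneg d n j
  have hd : (0 : ℝ) ≤ d := Nat.cast_nonneg d
  calc ∑ l : Fin (d + 1) → Fin n, ‖qa n l p‖ * ‖ew n l p‖
      ≤ ∑ l : Fin (d + 1) → Fin n, 1024 / 7 * ((d : ℝ) + 1) * ∏ i, wt d n (l i) := Finset.sum_le_sum fun l _ => norm_qa_mul_ew_le n hp l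
    _ = 1024 / 7 * ((d : ℝ) + 1) * (∑ j : Fin n, wt d n j) ^ (d + 1) := by rw [← Finset.mul_sum, sum_prod_wt_eq]
    _ ≤ Cqe d := by
        unfold Cqe
        exact mul_le_mul_of_nonneg_left (pow_le_pow_left₀ hw0 (sum_wt_le d n) _) (by positivity)

/-- [our object] **THE n-UNIFORM COLUMN ALIAS SUM**: `Σ_l ‖qb_l‖·‖e_l‖ ≤ Cqe D` on the fat strip, every `n ≥ 1`. -/
theorem sum_norm_qb_mul_ew_le (n : ℕ) [NeZero n] {p : Fin (d + 1) → ℂ} (hp : p ∈ Fat (d + 1) (rOf (d + 1))) :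
    ∑ l : Fin (d + 1) → Fin n, ‖qb n l p‖ * ‖ew n l p‖ ≤ Cqe d := by
  have hw0 : 0 ≤ ∑ j : Fin n, wt d n j := Finset.sum_nonneg fun j _ => wt_nonneg d n j
  have hd : (0 : ℝ) ≤ d := Nat.cast_nonneg d
  calc ∑ l : Fin (d + 1) → Fin n, ‖qb n l p‖ * ‖ew n l p‖
      ≤ ∑ l : Fin (d + 1) → Fin n, 1024 / 7 * ((d : ℝ) + 1) * ∏ i, wt d n (l i) := Finset.sum_le_sum fun l _ => norm_qb_mul_ew_le n hp l
    _ = 1024 / 7 * ((d : ℝ) + 1) * (∑ j : Fin n, wt d n j) ^ (d + 1) := by rw [← Finset.mul_sum, sum_prod_wt_eq]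
    _ ≤ Cqe d := by
        unfold Cqe
        exact mul_le_mul_of_nonneg_left (pow_le_pow_left₀ hw0 (sum_wt_le d n) _) (by positivity)

/-! ## §3 The END: the bound of `S`, strip regularity, and the decay of the fine kernel of `1 − Π` -/

/-- [our object] the `ℓ¹` size of an offset: `l1 a := Σ_μ |a_μ|`. -/
def l1 (a : Fin (d + 1) → ℤ) : ℝ := ∑ μ, |((a μ : ℤ) : ℝ)|

/-- [folklore] `0 ≤ l1 a`. -/
theorem l1_nonneg (a : Fin (d + 1) → ℤ) : 0 ≤ l1 a := Finset.sum_nonneg fun _ _ => abs_nonneg _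

/-- [folklore] `l1 (−a) = l1 a`. -/
theorem l1_neg (a : Fin (d + 1) → ℤ) : l1 (-a) = l1 a := by
  unfold l1
  refine Finset.sum_congr rfl fun μ _ => ?_
  rw [Pi.neg_apply, Int.cast_neg, abs_neg]

/-- [folklore] **THE CHARACTER ON A STRIP**: `|Im q_μ| ≤ κ ⟹ ‖cphase a q‖ ≤ e^{κ·l1 a}`. -/
theorem norm_cphase_le {q : Fin (d + 1) → ℂ} {κ : ℝ} (hq : ∀ μ, |(q μ).im| ≤ κ) (a : Fin (d + 1) → ℤ) :
    ‖cphase a q‖ ≤ Real.exp (κ * l1 a) := by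
  unfold cphase l1
  rw [Complex.norm_exp, Real.exp_le_exp]
  have hre : (I * ∑ μ, q μ * (a μ : ℂ)).re = -∑ μ, (q μ).im * ((a μ : ℤ) : ℝ) := by
    simp [Complex.mul_re, Complex.mul_im, Complex.im_sum]
  rw [hre, Finset.mul_sum, ← Finset.sum_neg_distrib]
  refine Finset.sum_le_sum fun μ _ => ?_
  calc -((q μ).im * ((a μ : ℤ) : ℝ)) ≤ |(q μ).im * ((a μ : ℤ) : ℝ)| := neg_le_abs _
    _ = |(q μ).im| * |((a μ : ℤ) : ℝ)| := abs_mul _ _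
    _ ≤ κ * |((a μ : ℤ) : ℝ)| := mul_le_mul_of_nonneg_right (hq μ) (abs_nonneg _)

/-- [our object] the lower constant of `𝒩` on the strip: `cN D := (4/π²)^{D}/2`. -/
def cN (d : ℕ) : ℝ := (4 / Real.pi ^ 2) ^ (d + 1) / 2

/-- [folklore] `0 < cN`. -/
theorem cN_pos (d : ℕ) : 0 < cN d := by unfold cN; positivity

/-- [our object] **THE STRIP BOUND OF THE FINE-KERNEL SYMBOL**: `MS d n a b := e^{κ_Y·l1 a/n}·e^{κ_Y·l1 b/n}·Cqe²/cN`. -/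
def MS (d n : ℕ) (a b : Fin (d + 1) → ℤ) : ℝ :=
  Real.exp (kapY (d + 1) / n * l1 a) * Real.exp (kapY (d + 1) / n * l1 b) * (Cqe d ^ 2 / cN d)

/-- [folklore] the norm of the pole-free entry: `‖A_{ll′}‖ = (‖qa_l‖‖e_l‖)(‖qb_{l′}‖‖e_{l′}‖)/‖𝒩‖`. -/
theorem norm_Aent_eq (n : ℕ) [NeZero n] (l l' : Fin (d + 1) → Fin n) (p : Fin (d + 1) → ℂ) :
    ‖Aent n l l' p‖ = ‖qa n l p‖ * ‖ew n l p‖ * (‖qb n l' p‖ * ‖ew n l' p‖) / ‖Ncal n p‖ := by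
  rw [Aent, norm_div, norm_mul, norm_mul, norm_mul]

/-- [our object] **THE n-CONTROLLED BOUND OF `S` ON THE STRIP**: `‖S n a b k‖ ≤ MS d n a b` for `k ∈ Strip D κ_Y`, every `n ≥ 1`. -/
theorem norm_S_le (n : ℕ) [NeZero n] (a b : Fin (d + 1) → ℤ) {k : Fin (d + 1) → ℂ} (hk : k ∈ Strip (d + 1) (kapY (d + 1))) :
    ‖S n a b k‖ ≤ MS d n a b := by
  have hn : (0 : ℝ) < n := by exact_mod_cast Nat.pos_of_ne_zero (NeZero.ne n)
  have hfat : k ∈ Fat (d + 1) (rOf (d + 1)) := strip_subset_fat (rOf_pos _).le (kapY_le_rOf _) hk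
  have hN : cN d ≤ ‖Ncal n k‖ := Ncal_lower n k hk
  have hcN := cN_pos d
  have him : ∀ (l : Fin (d + 1) → Fin n) (μ : Fin (d + 1)), |(aliasPt n l k μ).im| ≤ kapY (d + 1) / n := fun l μ => by
    rw [aliasPt_im, abs_div, Nat.abs_cast]; exact div_le_div_of_nonneg_right (hk μ).2 hn.le
  set Ea := Real.exp (kapY (d + 1) / n * l1 a) with hEa
  set Eb := Real.exp (kapY (d + 1) / n * l1 b) with hEb
  have hA : ∀ l l' : Fin (d + 1) → Fin n, ‖cphase a (aliasPt n l k) * Aent n l l' k * cphase (-b) (aliasPt n l' k)‖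
      ≤ Ea * Eb / cN d * ((‖qa n l k‖ * ‖ew n l k‖) * (‖qb n l' k‖ * ‖ew n l' k‖)) := by
    intro l l'
    rw [norm_mul, norm_mul, norm_Aent_eq]
    have h1 : ‖cphase a (aliasPt n l k)‖ ≤ Ea := norm_cphase_le (him l) a
    have h2 : ‖cphase (-b) (aliasPt n l' k)‖ ≤ Eb := by
      have h := norm_cphase_le (him l') (-b); rwa [l1_neg] at h
    have hT0 : 0 ≤ ‖qa n l k‖ * ‖ew n l k‖ * (‖qb n l' k‖ * ‖ew n l' k‖) := by positivity
    have h3 : ‖qa n l k‖ * ‖ew n l k‖ * (‖qb n l' k‖ * ‖ew n l' k‖) / ‖Ncal n k‖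
        ≤ ‖qa n l k‖ * ‖ew n l k‖ * (‖qb n l' k‖ * ‖ew n l' k‖) / cN d := div_le_div_of_nonneg_left hT0 hcN hN
    calc ‖cphase a (aliasPt n l k)‖ * (‖qa n l k‖ * ‖ew n l k‖ * (‖qb n l' k‖ * ‖ew n l' k‖) / ‖Ncal n k‖) * ‖cphase (-b) (aliasPt n l' k)‖
        ≤ Ea * (‖qa n l k‖ * ‖ew n l k‖ * (‖qb n l' k‖ * ‖ew n l' k‖) / cN d) * Eb :=
          mul_le_mul (mul_le_mul h1 h3 (by positivity) (by positivity)) h2 (norm_nonneg _) (by positivity)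
      _ = _ := by ring
  calc ‖S n a b k‖ ≤ ∑ l, ∑ l', ‖cphase a (aliasPt n l k) * Aent n l l' k * cphase (-b) (aliasPt n l' k)‖ := by
        unfold S; exact (norm_sum_le _ _).trans (Finset.sum_le_sum fun l _ => norm_sum_le _ _)
    _ ≤ ∑ l : Fin (d + 1) → Fin n, ∑ l' : Fin (d + 1) → Fin n, Ea * Eb / cN d * ((‖qa n l k‖ * ‖ew n l k‖) * (‖qb n l' k‖ * ‖ew n l' k‖)) :=
        Finset.sum_le_sum fun l _ => Finset.sum_le_sum fun l' _ => hA l l'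
    _ = Ea * Eb / cN d * ((∑ l : Fin (d + 1) → Fin n, ‖qa n l k‖ * ‖ew n l k‖) * (∑ l' : Fin (d + 1) → Fin n, ‖qb n l' k‖ * ‖ew n l' k‖)) := by
        rw [Finset.sum_mul_sum, Finset.mul_sum]
        exact Finset.sum_congr rfl fun l _ => by rw [Finset.mul_sum]
    _ ≤ Ea * Eb / cN d * (Cqe d * Cqe d) :=
        mul_le_mul_of_nonneg_left (mul_le_mul (sum_norm_qa_mul_ew_le n hfat) (sum_norm_qb_mul_ew_le n hfat)
          (Finset.sum_nonneg fun l _ => by positivity) (Cqe_nonneg d)) (by positivity)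
    _ = MS d n a b := by rw [MS, sq]; ring

/-- [our object] **THE FINE-KERNEL SYMBOL OF `1 − Π` IS STRIP-REGULAR**: `StripRegular (S n a b) κ_Y (MS d n a b)`, every `n ≥ 1`, all offsets. -/
theorem stripRegular_S (n : ℕ) [NeZero n] (a b : Fin (d + 1) → ℤ) :
    StripRegular (d := d) (fun k : Fin (d + 1) → ℂ => S n a b k) (kapY (d + 1)) (MS d n a b) :=
  stripRegular_S_of_bound n a b fun _ hk => norm_S_le n a b hk

/-- [our object] **THE FINE KERNEL OF `1 − Π` DECAYS EXPONENTIALLY ON THE COARSE SCALE**: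
`‖latticeKernel (S n a b) X‖ ≤ MS d n a b · e^{−κ_Y‖X‖∞}`, every `n ≥ 1`, all offsets `a, b`. -/
theorem norm_latticeKernel_S_le (n : ℕ) [NeZero n] (a b : Fin (d + 1) → ℤ) (X : Fin (d + 1) → ℤ) :
    ‖latticeKernel (fun k : Fin (d + 1) → ℂ => S n a b k) X‖ ≤ MS d n a b * Real.exp (-(kapY (d + 1) * supNorm X)) :=
  norm_latticeKernel_S_le_of_bound n a b (fun _ hk => norm_S_le n a b hk) X

/-- [our object] **THE n-UNIFORM CONSTANT FOR INTRA-BLOCK OFFSETS**: `CS D := (e^{κ_Y·D})²·Cqe²/cN` (dimension only). -/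
def CS (d : ℕ) : ℝ := Real.exp (kapY (d + 1) * ((d : ℝ) + 1)) ^ 2 * (Cqe d ^ 2 / cN d)

/-- [folklore] intra-block offsets (`|a_μ| ≤ n`) have `l1 a ≤ D·n`, so `κ_Y·l1 a/n ≤ κ_Y·D`. -/
theorem exp_offset_le (n : ℕ) [NeZero n] {a : Fin (d + 1) → ℤ} (ha : ∀ μ, |a μ| ≤ n) :
    Real.exp (kapY (d + 1) / n * l1 a) ≤ Real.exp (kapY (d + 1) * ((d : ℝ) + 1)) := by
  have hn : (0 : ℝ) < n := by exact_mod_cast Nat.pos_of_ne_zero (NeZero.ne n)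
  have hκ := (kapY_pos (d + 1)).le
  rw [Real.exp_le_exp]
  have h1 : l1 a ≤ ((d : ℝ) + 1) * n := by
    unfold l1
    calc ∑ μ, |((a μ : ℤ) : ℝ)| ≤ ∑ _μ : Fin (d + 1), (n : ℝ) := Finset.sum_le_sum fun μ _ => by
            rw [← Int.cast_abs]; exact_mod_cast ha μ
      _ = ((d : ℝ) + 1) * n := by rw [Finset.sum_const, Finset.card_univ, Fintype.card_fin]; ring
  calc kapY (d + 1) / n * l1 a ≤ kapY (d + 1) / n * (((d : ℝ) + 1) * n) := mul_le_mul_of_nonneg_left h1 (by positivity)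
    _ = kapY (d + 1) * ((d : ℝ) + 1) := by field_simp

/-- [folklore] `MS ≤ CS` for intra-block offsets. -/
theorem MS_le_CS (n : ℕ) [NeZero n] {a b : Fin (d + 1) → ℤ} (ha : ∀ μ, |a μ| ≤ n) (hb : ∀ μ, |b μ| ≤ n) :
    MS d n a b ≤ CS d := by
  have hC : 0 ≤ Cqe d ^ 2 / cN d := div_nonneg (sq_nonneg _) (cN_pos d).le
  unfold MS CS
  rw [sq (Real.exp _)]
  exact mul_le_mul_of_nonneg_right (mul_le_mul (exp_offset_le n ha) (exp_offset_le n hb) (by positivity) (by positivity)) hC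

/-- [our object] **THE n-UNIFORM END OF ROW GAMMA-3 (zeroth B-jet)**: for intra-block offsets `|a_μ|, |b_μ| ≤ n`,
`‖latticeKernel (S n a b) X‖ ≤ CS(D)·e^{−κ_Y‖X‖∞}` for every `n ≥ 1` and `X ∈ ℤ^{D}` — in the reading of `SliceProjectorSymbol`:
`|(1−Π)(nX + a, nY + b)| ≤ CS(D)·n^{−D}·e^{−κ_Y|X−Y|∞}`. -/
theorem norm_latticeKernel_S_le_uniform (n : ℕ) [NeZero n] {a b : Fin (d + 1) → ℤ} (ha : ∀ μ, |a μ| ≤ n) (hb : ∀ μ, |b μ| ≤ n)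
    (X : Fin (d + 1) → ℤ) :
    ‖latticeKernel (fun k : Fin (d + 1) → ℂ => S n a b k) X‖ ≤ CS d * Real.exp (-(kapY (d + 1) * supNorm X)) :=
  (norm_latticeKernel_S_le n a b X).trans (mul_le_mul_of_nonneg_right (MS_le_CS n ha hb) (Real.exp_pos _).le)

end Summit.QuantumFields.BalabanUV.Beta.FP.SliceProjectorAliasSum

end
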